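import Summits.QuantumFields.YangMills.Theorems.UnitScaleTiltProp7FrakGEq3152
import Summits.QuantumFields.YangMills.Theorems.UnitScaleTiltProp7ZeroModesOrthKerTopMean
import HarnessLib

/-!
# Route `UnitScaleTilt`, crux K1 «MinimiserStabilityRegPr» (stmt-QuantumFields-19200), EX row (5) `h3` (STOREY H), pipeline (ii) := «H2-LOC», brick **C6 / F2 — THE LOD THREE-PIECE FORM OF
# `ω₁`** (★CHAIR WORD №63 (1): ROAD OF RECORD for C6; px13 g17 LOCATE `LOCATE-C6-knit-px13g17.md` 94f33605, 19200 evidence #41).  STOREY H's Hölder-carrying object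
# `ω₁(A) := R_S(D*_{U₀}(G_{Δx}(toL2 A)))` is rewritten, by LANDED identities only, as
#     `ω₁ = w + (u − w) − G_a(T c(u))`,   `u := G_a(D*_{U₀}x)`,  `x = toL2 A`,
# where `w` is ANY solution of the H2-LOC carrier equation `(Δ^η_{U₀} + 1)w = D*_{U₀}x` (the object of the frozen letters `hHlocV`∕`hWsup`, RECORD 17dq), `u` solves the LOD-massive
# equation `Δ^η_{U₀}u + a•T(ι(Q″u)) = D*_{U₀}x` (= `hHlocV`'s equation shape with the penalty in the `q`-slot), `p := u − w` solves `Δ^η_{U₀}p + (a•T(ι(Q″u)) − w) = D*_{U₀}0`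
# (site data only — T1's shape), and `u − R_S u = G_a(T c(u))` is print's complementary projector in SOURCE FORM (P3v).  Consumed by F3 (`…OmegaOneAxialHolderKnit`) through the C6-PLUMBING
# conversions ✓∕⧗`Prop7LocalHolderToAxialLetter` (P0 additivity, P1 on `w`, P2∘T1 on `p`, P2∘`hDw` on `G_a(Tc(u))`).

THE IDENTITIES (all in the tree, by name).  (3.152)₁ ✓`Prop7FrakGEq3152.RS_DstarL2_GT_eq_RS_GprimeP_DstarL2` (class `PosOnto`, slot symmetric and killing `D N_S`): `R_S D* G_{Δx} x = R_S G′ᴾ_{a′} D* x`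
for every `0 ≤ a′`; ✓`Prop7ZeroModesOrthKerTopMean.RS_GprimeP_eq_RS_G` (the LOD lift letters `hseq hT hAG hGA hRS hker`): `R_S G′ᴾ_{a′} g = R_S G_a g` for EVERY site field `g`; hence
`ω₁ = R_S u`.  The two equations are `hAG` and the carrier hypothesis; the complementary projector identity is a DISPLAYED operator letter `hcompl : ∀ g, g − R_S g = G_a(T(cs g))` (supplier
P3v ✓`Prop7ComplementaryProjectorSourceForm.sub_projR_eq_G_lift_coeffSum` with `cs g = Σ_i λ_i(g)•b i`, read at `R_S` by `hRS`; its sup letter is P3v ✓`norm_equiv_complementary_source_apply_le`).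

Cell `ym3-torus` (HUMAN RULING D-0037; rung R3 = SU(2) YM₃ on T³ — NOT d = 4, NOT infinite volume, NOT a mass gap, NOT Clay).  Width seat `ym3-torus-px13` (gen 17);
`--supports stmt-QuantumFields-19200 --as helper`; count-neutral; THEOREMS ONLY (0 `def`, 0 `sorry`, default heartbeats).

WHAT IS PROVED (ns `Summit.QuantumFields.YangMills.Theorems.Prop7OmegaOneLODForm`; member `F n K`, `hnK : n ≤ K`, weights `c₀ c₁ cB > 0`; the LOD lift letters VERBATIM as in
✓`Prop7ZeroModesOrthKerTopMean` §LOD: `Q″ hseq ι T hT G hAG hGA hRS hker`, LOD mass `a`; the Hessian slot `Δx` with its class `PosOnto … aT Δx U₀` and rows `hΔs hΔ`).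
* §1 ★★ `RS_DstarL2_GT_eq_RS_G_DstarL2` — `ω₁ = R_S(G_a(D*x))`.
* §2 `G_DstarL2_equation` — `Δ^η u + a•T(ι(Q″u)) = D*x` for `u = G_a(D*x)` (= `hAG`); ★ `sub_carrier_equation` — for any `w` with `Δ^η w + 1•w = D*x`: `Δ^η(u − w) + (a•T(ι(Q″u)) − w) = D*0`.
* §3 ★★★ `omega_one_three_pieces` — under the displayed `hcompl`: `ω₁ = w + (u − w) − G_a(T(cs u))` in `SiteL2K`.
HYP-SAT (★★OWNER RULING №42).  `PosOnto`∕`hΔs`∕`hΔ` = S48–S50's class and slot rows (Π-slot: ✓`DeltaPiP_isSymmetric`, ✓`DeltaPiSlotP_kills_NS`); the lift letters are the R-editions'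
`Lift` antecedent (✓`RS_eq_projR_of_lift` lineage, K6∕W-families); `hcompl` ⟸ P3v by name; the carrier hypothesis is inhabited by `w := G_1(D*x)` (✓`covLapSite_add_pos`).  Conclusions are
equalities between displayed terms; nothing conclusion-shaped is assumed.  HONEST SCOPE: algebra (rewriting landed identities); no estimate; nothing of `hHlocV`, `hWsup`, `hUsup`, `h3`,
norm_G, EX, 19200 or the rung is proved; the Yang–Mills mass gap is NOT proved.

References: T. Bałaban, CMP **99** (1985) 389–434 [Balaban1985BackgroundPropagators] ((3.21)–(3.25) p.394, (3.118)–(3.122) pp.419–420, (3.151)–(3.152) pp.425–426, Thm 3.1 (3.42)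
p.397); CMP **102** (1985) 277–309 [Balaban1985Variational] ((117) p.295, (138)–(139) p.299).
-/

set_option autoImplicit false

noncomputable section

open scoped BigOperators Matrix.Norms.L2Operator InnerProductSpace ComplexConjugate Matrix

namespace Summit.QuantumFields.YangMills.Theorems.Prop7OmegaOneLODForm

open Literature.MathematicalPhysics.QuantumFieldTheory.Balaban1983to89
open Literature.MathematicalPhysics.QuantumFieldTheory.Balaban1983to89.T3ContinuumYM3Torus
open T4Continuum BlockAveraging
open BlockAveraging (Idx off)
open B7Prop1Explicit (disp)
open B10Eq27TorusAxialLog (holT transl)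
open B7TransferAnalyticMean (meanCLM)
open B11Eq103H1Complex (SiteL2K BondL2K projR)
open Summit.QuantumFields.YangMills.Theorems.Prop8Chart (emlIterU)
open T3SectALandauChart (bgUnits)
open Summit.QuantumFields.YangMills.Theorems.Prop7SectET3Transport (periodsT3)
open Summit.QuantumFields.YangMills.Theorems.Prop7SectET3HilbertLetters (W₂ toL2S DL2 DstarL2 covLapSite)
open Summit.QuantumFields.YangMills.Theorems.Prop7SectET3GaugeProjector (NS RS)
open Summit.QuantumFields.YangMills.Theorems.Prop7SectET3CurvedPropagators (PosOnto GT)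
open Summit.QuantumFields.YangMills.Theorems.Prop7FrakGEq3152 (RS_DstarL2_GT_eq_RS_GprimeP_DstarL2)
open Summit.QuantumFields.YangMills.Theorems.Prop7ZeroModesOrthKerTopMean (RS_GprimeP_eq_RS_G)

variable (F : T3Family) {n K : ℕ} (hnK : n ≤ K) {c₀ c₁ cB : ℝ} [Fact (0 < c₀)] [Fact (0 < c₁)] [Fact (0 < cB)]
  (U₀ : GaugeField (F.P K) 0 (Matrix.specialUnitaryGroup (Fin 2) ℂ))
  (Q'' : SiteL2K ℂ 3 (periodsT3 F K) c₀ W₂ →ₗ[ℂ] (Site (F.P K) (K - n) → Matrix (Fin 2) (Fin 2) ℂ))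
  (hseq : ∀ lam : Site (F.P K) 0 → Matrix (Fin 2) (Fin 2) ℂ, ∃ ns : (j : ℕ) → Site (F.P K) j → Matrix (Fin 2) (Fin 2) ℂ, ns 0 = lam ∧
      (∀ (j : ℕ) (y : Site (F.P K) (j + 1)), ns (j + 1) y = ns j (emb y) - meanCLM (Idx (F.P K)) (Matrix (Fin 2) (Fin 2) ℂ) fun i : Idx (F.P K) =>
        ns j (emb y) - ((holT (emlIterU j (bgUnits F K U₀)) (emb y) (stairWord i.2.1 (off i.1)) : (Matrix (Fin 2) (Fin 2) ℂ)ˣ) : Matrix (Fin 2) (Fin 2) ℂ) *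
          ns j (transl (emb y) (disp (stairWord i.2.1 (off i.1)))) * (((holT (emlIterU j (bgUnits F K U₀)) (emb y) (stairWord i.2.1 (off i.1)))⁻¹ : (Matrix (Fin 2) (Fin 2) ℂ)ˣ) : Matrix (Fin 2) (Fin 2) ℂ)) ∧
      ns (K - n) = Q'' (toL2S F K c₀ lam))
  (ι : (Site (F.P K) (K - n) → Matrix (Fin 2) (Fin 2) ℂ) →ₗ[ℂ] SiteL2K ℂ 3 (periodsT3 F n) c₁ W₂)
  (T : SiteL2K ℂ 3 (periodsT3 F n) c₁ W₂ →ₗ[ℂ] SiteL2K ℂ 3 (periodsT3 F K) c₀ W₂)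
  (hT : ∀ (l : SiteL2K ℂ 3 (periodsT3 F K) c₀ W₂) (f : SiteL2K ℂ 3 (periodsT3 F n) c₁ W₂), ⟪ι (Q'' l), f⟫_ℂ = ⟪l, T f⟫_ℂ)
  {a : ℝ}
  (G : SiteL2K ℂ 3 (periodsT3 F K) c₀ W₂ →ₗ[ℂ] SiteL2K ℂ 3 (periodsT3 F K) c₀ W₂)
  (hAG : ∀ f, covLapSite F n K c₀ U₀ (G f) + (a : ℂ) • T (ι (Q'' (G f))) = f)
  (hGA : ∀ u, G (covLapSite F n K c₀ U₀ u + (a : ℂ) • T (ι (Q'' u))) = u)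
  (hRS : RS F n K hnK c₀ cB U₀ = projR (covLapSite F n K c₀ U₀) Q'')
  (hker : LinearMap.ker Q'' ≤ NS F n K hnK c₀ cB U₀)

/-! ## §1 `ω₁ = R_S(G_a(D*x))` -/

include hseq hT hAG hGA hRS hker in
/-- ★★ **`ω₁ = R_S(G_a(D*_{U₀}x))`**: STOREY H's `ω₁ = R_S(D*_{U₀}(G_{Δx}x))` equals `R_S` of the LOD-MASSIVE resolvent of the divergence datum — (3.152)₁ ✓`RS_DstarL2_GT_eq_RS_GprimeP_DstarL2`
(class `PosOnto`, slot `Δx` symmetric and killing `D N_S`; pseudo-inverse parameter `a′ := a`) followed by ✓`RS_GprimeP_eq_RS_G` (`R_SG′ᴾ_a = R_SG_a` on every site field; the LOD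
lift letters).  The Hessian slot has DISAPPEARED from the Hölder-carrying object. [cite: Balaban1985BackgroundPropagators, (3.151)–(3.152) pp.425–426, (3.21)–(3.25) p.394] -/
theorem RS_DstarL2_GT_eq_RS_G_DstarL2 (ha : 0 ≤ a) {aT : ℝ}
    {Δx : GaugeField (F.P K) 0 (Matrix.specialUnitaryGroup (Fin 2) ℂ) → (BondL2K ℂ 3 (periodsT3 F K) c₀ W₂ →ₗ[ℂ] BondL2K ℂ 3 (periodsT3 F K) c₀ W₂)}
    (hp : PosOnto F n K hnK c₀ cB aT Δx U₀) (hΔs : (Δx U₀).IsSymmetric) (hΔ : ∀ l ∈ NS F n K hnK c₀ cB U₀, Δx U₀ (DL2 F n K c₀ U₀ l) = 0)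
    (x : BondL2K ℂ 3 (periodsT3 F K) c₀ W₂) :
    RS F n K hnK c₀ cB U₀ (DstarL2 F n K c₀ U₀ (GT F n K hnK c₀ cB aT Δx U₀ x)) = RS F n K hnK c₀ cB U₀ (G (DstarL2 F n K c₀ U₀ x)) := by
  rw [RS_DstarL2_GT_eq_RS_GprimeP_DstarL2 hp hΔs hΔ ha x, RS_GprimeP_eq_RS_G F hnK U₀ Q'' hseq ι T hT G hAG hGA hRS hker ha]

/-! ## §2 The equations of `u := G_a(D*x)` and of `p := u − w` -/

include hAG in
omit [Fact (0 < c₁)] in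
/-- **THE LOD-MASSIVE EQUATION OF `u := G_a(D*_{U₀}x)`**: `Δ^η_{U₀}u + a•T(ι(Q″u)) = D*_{U₀}x` (the letter `hAG`) — the shape `covLapSite V u + q = DstarL2 V f` of the local Hölder letter `hHlocV`
with `q :=` the LOD penalty and `f := x`. [cite: Balaban1985BackgroundPropagators, (3.24)–(3.25) p.394] -/
theorem G_DstarL2_equation (x : BondL2K ℂ 3 (periodsT3 F K) c₀ W₂) :
    covLapSite F n K c₀ U₀ (G (DstarL2 F n K c₀ U₀ x)) + (a : ℂ) • T (ι (Q'' (G (DstarL2 F n K c₀ U₀ x)))) = DstarL2 F n K c₀ U₀ x :=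
  hAG _

include hAG in
omit [Fact (0 < c₁)] in
/-- ★ **THE EQUATION OF `p := u − w`**: for any `w` with the H2-LOC carrier equation `Δ^η_{U₀}w + 1•w = D*_{U₀}x`, the difference `p = G_a(D*x) − w` solves
`Δ^η_{U₀}p + (a•T(ι(Q″u)) − w) = D*_{U₀}0` — SITE data only (the two equations subtracted), the shape of T1 ✓`gradient_decay_of_decay_allMembers`.
[cite: Balaban1985BackgroundPropagators, (3.24)–(3.25) p.394, Thm 3.1 (3.42) p.397] -/
theorem sub_carrier_equation (x : BondL2K ℂ 3 (periodsT3 F K) c₀ W₂) (w : SiteL2K ℂ 3 (periodsT3 F K) c₀ W₂)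
    (hw : covLapSite F n K c₀ U₀ w + ((1 : ℝ) : ℂ) • w = DstarL2 F n K c₀ U₀ x) :
    covLapSite F n K c₀ U₀ (G (DstarL2 F n K c₀ U₀ x) - w) + ((a : ℂ) • T (ι (Q'' (G (DstarL2 F n K c₀ U₀ x)))) - w) = DstarL2 F n K c₀ U₀ 0 := by
  have hu := hAG (DstarL2 F n K c₀ U₀ x)
  rw [Complex.ofReal_one, one_smul] at hw
  rw [map_zero, map_sub]
  calc covLapSite F n K c₀ U₀ (G (DstarL2 F n K c₀ U₀ x)) - covLapSite F n K c₀ U₀ w + ((a : ℂ) • T (ι (Q'' (G (DstarL2 F n K c₀ U₀ x)))) - w)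
      = (covLapSite F n K c₀ U₀ (G (DstarL2 F n K c₀ U₀ x)) + (a : ℂ) • T (ι (Q'' (G (DstarL2 F n K c₀ U₀ x))))) - (covLapSite F n K c₀ U₀ w + w) := by abel
    _ = 0 := by rw [hu, hw, sub_self]

/-! ## §3 ★★★ The three-piece form -/

include hseq hT hAG hGA hRS hker in
/-- ★★★ **THE LOD THREE-PIECE FORM OF `ω₁`** (★CHAIR WORD №63 (1), C6's road of record): under the displayed complementary-projector identity `hcompl : ∀ g, g − R_S g = G_a(T(cs g))`
(P3v ✓`sub_projR_eq_G_lift_coeffSum` in source form), for every bond datum `x` and every carrier solution `w`: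
`R_S(D*_{U₀}(G_{Δx}x)) = w + (G_a(D*x) − w) − G_a(T(cs(G_a(D*x))))` — piece 1 carries the local ½-Hölder letter (`hHlocV`), pieces 2–3 carry SUP letters only (T1 ∕ `hDw`).
[cite: Balaban1985BackgroundPropagators, (3.21)–(3.25) p.394, (3.151)–(3.152) pp.425–426, Thm 3.1 (3.42)–(3.43) pp.397–398] -/
theorem omega_one_three_pieces (ha : 0 ≤ a) {aT : ℝ}
    {Δx : GaugeField (F.P K) 0 (Matrix.specialUnitaryGroup (Fin 2) ℂ) → (BondL2K ℂ 3 (periodsT3 F K) c₀ W₂ →ₗ[ℂ] BondL2K ℂ 3 (periodsT3 F K) c₀ W₂)}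
    (hp : PosOnto F n K hnK c₀ cB aT Δx U₀) (hΔs : (Δx U₀).IsSymmetric) (hΔ : ∀ l ∈ NS F n K hnK c₀ cB U₀, Δx U₀ (DL2 F n K c₀ U₀ l) = 0)
    {C : Type*} (cs : SiteL2K ℂ 3 (periodsT3 F K) c₀ W₂ → C) (Tc : C → SiteL2K ℂ 3 (periodsT3 F K) c₀ W₂)
    (hcompl : ∀ g : SiteL2K ℂ 3 (periodsT3 F K) c₀ W₂, g - RS F n K hnK c₀ cB U₀ g = G (Tc (cs g)))
    (x : BondL2K ℂ 3 (periodsT3 F K) c₀ W₂) (w : SiteL2K ℂ 3 (periodsT3 F K) c₀ W₂) :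
    RS F n K hnK c₀ cB U₀ (DstarL2 F n K c₀ U₀ (GT F n K hnK c₀ cB aT Δx U₀ x))
      = w + (G (DstarL2 F n K c₀ U₀ x) - w) - G (Tc (cs (G (DstarL2 F n K c₀ U₀ x)))) := by
  rw [RS_DstarL2_GT_eq_RS_G_DstarL2 F hnK U₀ Q'' hseq ι T hT G hAG hGA hRS hker ha hp hΔs hΔ x, ← hcompl]
  abel

end Summit.QuantumFields.YangMills.Theorems.Prop7OmegaOneLODForm

end
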